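import Literature.Computability.Complexity.InnerProductDiscrepancy
import Literature.Combinatorics.Optimization.PatternMatrixRankUpperBounds
import Literature.Barriers.PneNP.ExtendedFormulationYannakakisConverse
import HarnessLib

/-!
# Deterministic protocols give nonnegative factorizations and extended formulations
# (Yannakakis 1991; Faenza–Fiorini–Grappe–Tiwary §3.1) — PROVED

Source: Y. Faenza, S. Fiorini, R. Grappe, H. R. Tiwary, *Extended formulations, nonnegative
factorizations, and randomized communication protocols* [FaenzaFioriniGrappeTiwary2015], §3.1
(deterministic protocols; ISCO 2012 / arXiv:1105.4127 numbering). Verbatim: "Now consider a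
deterministic protocol computing `f`. Since the protocol is deterministic, each of its leaves `v`
determines a subset of rows `R = R_v` and columns `C = C_v` such that any input `(x_i,y_j)`, the
execution of the protocol on `(x_i,y_j)` ends at leaf `v` if and only if … `(i,j) ∈ R × C`. On each of the
inputs `(x_i,y_j)` with `(i,j) ∈ R × C`, the function `f` evaluates to same value, namely the value at
leaf `v`. … When `v` varies among the leaves of the protocol, the rectangles `R_v × C_v` form a partition
of `[m] × [n]`. It is easy to see that such a partition can be used to write `M` as a sum of
non-negative rank one matrices, one for each leaf. … If `M` is the slack matrix of a polytope `P`, it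
follows from Theorem 1 [Yannakakis' factorization theorem] that `P` has an extension of size at most
`|L| ≤ 2^c`, where `c` is the complexity of the protocol. This was first observed by Yannakakis."

## What is proved (tree models `DetProtocol`, `HasNonnegFactorization`, `HasEFOfSize`)

* `DetProtocol.hasNonnegFactorization_of_run` — if a deterministic protocol tree `P` (outputs in any
  type `β`, read through a valuation `val : β → ℝ`) computes a nonnegative matrix `M`, then `M` has a
  nonnegative factorization with `leafCount P ≤ 2^{depth P}` terms (one per leaf rectangle, from
  `DetProtocol.exists_leafPartition`); `FaenzaFioriniGrappeTiwary2015_det` — the `2^c` form;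
* `Yannakakis1991_ef_of_detProtocol` — if a deterministic protocol of complexity `c` computes the slack
  matrix of a complete inequality description of `P = conv(V)`, then `P` has an extended formulation of
  size `2^c` (via the tree's `hasEFOfSize_of_complete_nonneg_factorization`).
-/

noncomputable section

namespace Literature.Computability.Complexity

open Finset
open Literature.Combinatorics.Optimization (HasNonnegFactorization)

namespace DetProtocol

variable {X Y β : Type*}

/-- **The leaf rectangles of a deterministic protocol give a nonnegative factorization, one term per
leaf**: if `val (P.run x y) = M x y ≥ 0` for all inputs, then `M` has a nonnegative factorization of
size `leafCount P`. [cite: FaenzaFioriniGrappeTiwary2015, §3.1 ("such a partition can be used to write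
`M` as a sum of non-negative rank one matrices, one for each leaf")] -/
theorem hasNonnegFactorization_of_run (P : DetProtocol X Y β) (val : β → ℝ) (M : X → Y → ℝ)
    (hM : ∀ x y, val (P.run x y) = M x y) (hpos : ∀ x y, 0 ≤ M x y) :
    HasNonnegFactorization M P.leafCount := by
  classical
  obtain ⟨ι, hι, hcard, a, b, c, ha, hb, hsum, hrun⟩ := exists_leafPartition P
  -- one nonnegative rank-one term per leaf: `a_i(x) · (b_i(y) · max(val c_i, 0))`
  have hfac : HasNonnegFactorization M (Fintype.card ι) := by
    let e := Fintype.equivFin ι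
    refine ⟨fun x l => a (e.symm l) x, fun l y => b (e.symm l) y * max (val (c (e.symm l))) 0,
      fun x l => ?_, fun l y => ?_, fun x y => ?_⟩
    · rcases ha (e.symm l) x with h | h <;> simp [h]
    · exact mul_nonneg (by rcases hb (e.symm l) y with h | h <;> simp [h]) (le_max_right _ _)
    · -- the unique leaf rectangle containing `(x, y)` carries the value `M x y ≥ 0`
      have hterm : ∀ i, a i x * (b i y * max (val (c i)) 0) = a i x * b i y * M x y := by
        intro i
        rcases ha i x with h | h
        · simp [h]
        · rcases hb i y with h' | h'
          · simp [h']
          · rw [← hM x y, hrun i x y h h', max_eq_left (by rw [← hrun i x y h h', hM x y]; exact hpos x y)]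
            ring
      calc M x y = (∑ i, a i x * b i y) * M x y := by rw [hsum x y, one_mul]
        _ = ∑ i, a i x * (b i y * max (val (c i)) 0) := by
            rw [Finset.sum_mul]
            exact Finset.sum_congr rfl fun i _ => (hterm i).symm
        _ = ∑ l, a (e.symm l) x * (b (e.symm l) y * max (val (c (e.symm l))) 0) :=
            Fintype.sum_equiv e _ _ fun i => by simp only [Equiv.symm_apply_apply]
        _ = _ := rfl
  exact hfac.mono hcard

end DetProtocol

/-- **Deterministic protocols give nonnegative factorizations of size `2^c`** (the deterministic case
of Faenza–Fiorini–Grappe–Tiwary's Theorem 2; Yannakakis 1991).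
[cite: FaenzaFioriniGrappeTiwary2015, §3.1 ("`P` has an extension of size at most `|L| ≤ 2^c`")] -/
theorem FaenzaFioriniGrappeTiwary2015_det {X Y β : Type*} (P : DetProtocol X Y β) (val : β → ℝ)
    (M : X → Y → ℝ) (hM : ∀ x y, val (P.run x y) = M x y) (hpos : ∀ x y, 0 ≤ M x y) :
    HasNonnegFactorization M (2 ^ P.depth) :=
  (DetProtocol.hasNonnegFactorization_of_run P val M hM hpos).mono
    (DetProtocol.leafCount_le_two_pow_depth P)

open Literature.Barriers.PneNP in
/-- **Yannakakis: a deterministic protocol for the slack matrix gives an extended formulation.** Let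
`P = conv(v_b : b ∈ B)` with a complete inequality description `(c_a · x ≤ d_a)_{a ∈ A}`. If a
deterministic protocol of complexity `c` (Alice holding the constraint index `a`, Bob the vertex `b`;
outputs read through `val`) computes the slack `d_a − c_a · v_b` of inequalities valid on the `v_b`,
then `P` has an extended formulation of size `2^c`. [cite: FaenzaFioriniGrappeTiwary2015, §3.1 ("it follows from Theorem 1 that `P` has an
extension of size at most `|L| ≤ 2^c` … This was first observed by Yannakakis")]
[cite: Yannakakis1991, §5 (p. 462, "a deterministic protocol … gives a linear program")] -/
theorem Yannakakis1991_ef_of_detProtocol {ι A B β : Type} [Fintype ι] [Fintype B]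
    (v : B → ι → ℝ) (c : A → ι → ℝ) (d : A → ℝ)
    (hcomplete : ∀ x : ι → ℝ, (∀ a, c a ⬝ᵥ x ≤ d a) → x ∈ convexHull ℝ (Set.range v))
    (hvalid : ∀ a b, c a ⬝ᵥ v b ≤ d a)
    (P : DetProtocol A B β) (val : β → ℝ) (hslack : ∀ a b, val (P.run a b) = d a - c a ⬝ᵥ v b) :
    HasEFOfSize (convexHull ℝ (Set.range v)) (2 ^ P.depth) := by
  obtain ⟨U, W, hU, hW, hfac⟩ := FaenzaFioriniGrappeTiwary2015_det P val
    (fun a b => d a - c a ⬝ᵥ v b) hslack (fun a b => sub_nonneg.2 (hvalid a b))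
  have h := hasEFOfSize_of_complete_nonneg_factorization v c d hcomplete U (fun b i => W i b) hU
    (fun b i => hW i b) (fun a b => hfac a b)
  simpa using h

end Literature.Computability.Complexity
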